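import Summits.QuantumFields.BalabanUV.T4Continuum.Support.NE3HodgeCoexactPoincare
import HarnessLib

/-!
# T⁴ programme, node NE3 — row H2, η-CENTRIC SPELLING (the owner's socket names): the co-closed part `η` of a tangent
# `Y = η + dPot ζ` has exact iterated averages; `Σ‖η‖² ≤ 9·(L^k)²·Σ‖curl (η + dPot ζ)‖²`,
# `Σ_z‖(Qcoarse L)^[k] η‖² ≤ ((L^k)^d)⁻¹(L^k)⁴·Σ‖curl (η + dPot ζ)‖²` — N-FREE (complex values)

NE3 formalisation swarm `b2b-balaban-t4-ne3-formalise-*`, LEAF PROVER 03 (unit `b2b-balaban-t4-ne3-formalise-leaf-03`, gen 7; cell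
`pub-balaban`), row **H2** of ruling ρ-g21-4 (W4)(i) (journal l.16470; CLAIM l.16676; file 1 `NE3HodgeCoexactPoincare` p225145).
THIS FILE serves, under the SAME namespace `…NE3HodgeCoexactPoincare`, the ELEVEN η-centric statements of the row NE3 OWNER
`b2b-balaban-t4-ne3-p1` (gen 22)'s staged twin `t4/b2b-balaban-t4-ne3-p1/g22/lean/NE3HodgeCoexactPoincare.v1.staged.lean`
(sha16 463f669fc9b2b28f; INTENT journal l.16685, written independently of file 1 in the same hour) with SIGNATURES BYTE-IDENTICAL to
that file, so that the owner's H5a socket `NE3SlicePoincareAssembly` (ruling ρ-g22-1, l.16859) elaborates after changing one import.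
AUTHORSHIP: statements and the short identity proofs of §1∕§3 are the owner's (credited); the estimates of §2 are three-line corollaries
of file 1's η-intrinsic theorems `sum_norm_sq_le_of_iterate_Qcoarse_eq_dPot_of_flatDiv` ∕ `sum_norm_sq_iterate_Qcoarse_le_of_exact_of_flatDiv`
∕ `sum_diag_grad_sq_le` (Q-exactness with the potential `ψ := framePot L k η − ζ∘((L^k)•·)`, never estimated).

DICTIONARY (file 1 is Y-centric: `Y` tangent, `ζ` periodic, `η := Y − dPot ζ`; here `η`, `ζ` are the binders and `Y := η + dPot ζ` is tangent):
`dPot_sub'` = `dPot_sub`; `iterate_Qcoarse_coexact` ↔ `iterate_Qcoarse_coexact_eq_dPot'`; `psi_add_period` ↔ `coexactPot_add_period`;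
`planeCurl_add_dPot` ↔ `fdCurl_sub_dPot`; `sum_norm_sq_coexact_le_planeCurl` ∕ `sum_norm_sq_iterate_Qcoarse_coexact_le_planeCurl` ↔
`sum_norm_sq_coexact_le_curl` ∕ `sum_norm_sq_iterate_Qcoarse_coexact_le_curl`.

CONTENT (all [folklore]; 0 sorry; 0 `def`): §1 `dPot_sub'`, **`iterate_Tcoarse_coexact`** (`(Tcoarse L)^[k] η = −dPot (ζ∘((L^k)•·))`),
**`iterate_Qcoarse_coexact`** (`(Qcoarse L)^[k] η = dPot ψ`; equivalently the CORNER DATUM `ζ((L^k)•w) = framePot L k η w − ψ w`),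
`psi_add_period`; §2 `lineSum_coexact_eq`, **`sum_norm_sq_coexact_le_grad`** (`Σ‖η‖² ≤ 9(L^k)²·G(η)`),
**`sum_norm_sq_iterate_Qcoarse_coexact_le`** (S-bound); §3 `planeCurl_add_dPot`, `sum_grad_sq_coexact_eq_planeCurl` (Weitzenböck),
**`sum_norm_sq_coexact_le_planeCurl`**, **`sum_norm_sq_iterate_Qcoarse_coexact_le_planeCurl`** — N-FREE, k-free, L-free.

HONEST FRAMING.  Flat finite-lattice vector calculus on OUR typed objects at ONE (flat) configuration; (P♮)-flat needs H1∕H3∕H4∕H5 on top;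
(P♮) at `W ≠ 1`, (ML_w) curved, T-E_w and NE3 are NOT proved; nothing about Bałaban's minimisers; spine PROVED 0∕9; finite T⁴ rung (B)+1 —
NOT infinite volume, NOT mass gap, NOT BetaPertH, NOT Clay.  ABSOLUTE RULE kept (nothing printed is a hypothesis; context only:
[Balaban1985PropagatorsII] Thm 3.3 (3.46)).  PLACEMENT: `Summits/QuantumFields/BalabanUV/`; imports the accepted file 1 only.
-/

set_option autoImplicit false

open scoped BigOperators
open Finset

namespace Summit.QuantumFields.BalabanUV.T4Continuum.NE3HodgeCoexactPoincare

open Literature.MathematicalPhysics.QuantumFieldTheory.Balaban1983to89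
open B7Prop1Explicit
open T4AveragingDeficitWall (Plane)
open T4AveragingDeficitWallBoundary (periodBox mem_periodBox card_periodBox sum_periodBox_shift)
open NE3TangentNoGoWords (dPot)
open SmoothRefineNeutral (Tcoarse)
open NE3TangentFlatStructure (Qcoarse framePot iterate_Tcoarse_eq framePot_add_period dPot_add_period)
open NE3FramePotGauge (iterate_Tcoarse_dPot iterate_Tcoarse_add)
open NE3BlockLineAverage (iterate_Qcoarse_apply)
open NE3LatticeWeitzenbock (weitzenbock_periodBox_of_div_eq_zero)

noncomputable section

variable {d : ℕ}

/-! ## §1 Identities: the iterated averages of the co-closed part are exact (owner's statements and proofs) -/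

section Identities

variable {𝔸 : Type*} [NormedRing 𝔸] [NormedAlgebra ℂ 𝔸]

omit [NormedAlgebra ℂ 𝔸] in
/-- The coboundary of a difference of potentials (= file 1's `dPot_sub`). [folklore] -/
theorem dPot_sub' (A B : Site d → 𝔸) (z : Site d) (κ : Fin d) :
    dPot (fun w => A w - B w) z κ = dPot A z κ - dPot B z κ :=
  dPot_sub A B z κ

/-- **THE k-FOLD CONTOUR AVERAGE OF THE CO-CLOSED PART**: if `Y = η + dPot ζ` is tangent (`(Tcoarse L)^[k] Y = 0`, `L ≥ 1`) then
`(Tcoarse L)^[k] η z κ = −dPot (ζ ∘ (L^k•)) z κ` (Φ1's `iterate_Tcoarse_dPot` and additivity; owner t4-ne3-p1 g22). [folklore] -/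
theorem iterate_Tcoarse_coexact {L : ℕ} (hL : 1 ≤ L) (k : ℕ) (η : Site d → Fin d → 𝔸) (ζ : Site d → 𝔸)
    (hT : (Tcoarse L)^[k] (fun x μ => η x μ + dPot ζ x μ) = 0) (z : Site d) (κ : Fin d) :
    (Tcoarse L)^[k] η z κ = -dPot (fun w => ζ (((L : ℤ) ^ k) • w)) z κ := by
  have hadd := congr_fun (congr_fun (iterate_Tcoarse_add L k η (dPot ζ)) z) κ
  have hex := congr_fun (congr_fun (iterate_Tcoarse_dPot (𝔸 := 𝔸) hL k ζ) z) κ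
  have h0 : (Tcoarse L)^[k] (fun x μ => η x μ + dPot ζ x μ) z κ = 0 := by rw [hT]; rfl
  rw [hadd, hex] at h0
  exact eq_neg_of_add_eq_zero_left h0

/-- **THE k-FOLD STRAIGHT AVERAGE OF THE CO-CLOSED PART IS EXACT**: if `Y = η + dPot ζ` is tangent (`L ≥ 1`) then
`(Qcoarse L)^[k] η z κ = dPot ψ z κ` with **`ψ w := framePot L k η w − ζ ((L^k)•w)`** (the frames are coarse-exact, `iterate_Tcoarse_eq`,
plus `iterate_Tcoarse_coexact`).  Equivalently the CORNER DATUM `ζ((L^k)•w) = framePot L k η w − ψ w` (owner t4-ne3-p1 g22). [folklore] -/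
theorem iterate_Qcoarse_coexact {L : ℕ} (hL : 1 ≤ L) (k : ℕ) (η : Site d → Fin d → 𝔸) (ζ : Site d → 𝔸)
    (hT : (Tcoarse L)^[k] (fun x μ => η x μ + dPot ζ x μ) = 0) (z : Site d) (κ : Fin d) :
    (Qcoarse L)^[k] η z κ = dPot (fun w => framePot L k η w - ζ (((L : ℤ) ^ k) • w)) z κ := by
  have h1 := iterate_Tcoarse_eq hL k η z κ
  rw [iterate_Tcoarse_coexact hL k η ζ hT z κ, eq_sub_iff_add_eq] at h1
  rw [dPot_sub', ← h1]
  abel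

/-- The potential `ψ = framePot L k η − ζ ∘ (L^k•)` is `N`-periodic when `η` and `ζ` are `(L^k·N)`-periodic (owner t4-ne3-p1 g22).
[folklore] -/
theorem psi_add_period (L : ℕ) (k : ℕ) {N : ℕ} (η : Site d → Fin d → 𝔸) (ζ : Site d → 𝔸)
    (hη : ∀ (x : Site d) (τ μ : Fin d), η (x + ((L ^ k * N : ℕ) : ℤ) • e τ) μ = η x μ)
    (hζ : ∀ (x : Site d) (τ : Fin d), ζ (x + ((L ^ k * N : ℕ) : ℤ) • e τ) = ζ x)
    (z : Site d) (τ : Fin d) :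
    framePot L k η (z + (N : ℤ) • e τ) - ζ (((L : ℤ) ^ k) • (z + (N : ℤ) • e τ))
      = framePot L k η z - ζ (((L : ℤ) ^ k) • z) := by
  have hη' : ∀ (y : Site d) (τ' μ : Fin d), η (y + ((L : ℤ) ^ k * N) • e τ') μ = η y μ := by
    intro y τ' μ; have := hη y τ' μ; push_cast at this; exact this
  have hF := framePot_add_period L k η hη' z τ
  have hZ : ζ (((L : ℤ) ^ k) • (z + (N : ℤ) • e τ)) = ζ (((L : ℤ) ^ k) • z) := by
    have := hζ (((L : ℤ) ^ k) • z) τ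
    rw [smul_add, smul_smul]
    push_cast at this
    exact this
  rw [hF, hZ]

end Identities

/-! ## §2 Estimates for the co-closed part (complex values): file 1's Q-exact theorems with the potential `ψ` -/

section Estimates

/-- **THE LINE SUMS OF THE CO-CLOSED PART ARE EXACT**: `Σ_v Σ_{i<L^k} η(L^k•z+v+i e_κ) κ = (L^k)^d • dPot ψ z κ`. [folklore] -/
theorem lineSum_coexact_eq {L : ℕ} (hL : 1 ≤ L) (k : ℕ) (η : Site d → Fin d → ℂ) (ζ : Site d → ℂ)
    (hT : (Tcoarse L)^[k] (fun x μ => η x μ + dPot ζ x μ) = 0) (z : Site d) (κ : Fin d) :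
    ∑ v ∈ periodBox (d := d) (L ^ k), ∑ i ∈ range (L ^ k), η (((L ^ k : ℕ) : ℤ) • z + v + (i : ℤ) • e κ) κ
      = ((((L ^ k : ℕ) : ℝ)) ^ d) • dPot (fun w => framePot L k η w - ζ (((L : ℤ) ^ k) • w)) z κ :=
  lineSum_eq_of_iterate_Qcoarse_eq_dPot hL k η _ (funext fun w => funext fun μ => iterate_Qcoarse_coexact hL k η ζ hT w μ) z κ

/-- **BLOCK-POINCARÉ FOR THE CO-CLOSED PART, N-FREE** (complex values): `L, N ≥ 1`; `η` and `ζ` `(L^k·N)`-periodic,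
`Y = η + dPot ζ` tangent (`(Tcoarse L)^[k] Y = 0`), `η` flat-divergence-free.  Then
`Σ_x Σ_κ ‖η x κ‖² ≤ 9·(L^k)²·Σ_x Σ_κ Σ_μ ‖η(x+e_μ) κ − η x κ‖²` over `periodBox (L^k·N)` (file 1's
`sum_norm_sq_le_of_iterate_Qcoarse_eq_dPot_of_flatDiv` with the potential `ψ`). [folklore] -/
theorem sum_norm_sq_coexact_le_grad {L : ℕ} (hL : 1 ≤ L) {N : ℕ} (hN : 1 ≤ N) (k : ℕ)
    (η : Site d → Fin d → ℂ) (ζ : Site d → ℂ)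
    (hη : ∀ (x : Site d) (τ μ : Fin d), η (x + ((L ^ k * N : ℕ) : ℤ) • e τ) μ = η x μ)
    (hζ : ∀ (x : Site d) (τ : Fin d), ζ (x + ((L ^ k * N : ℕ) : ℤ) • e τ) = ζ x)
    (hT : (Tcoarse L)^[k] (fun x μ => η x μ + dPot ζ x μ) = 0)
    (hdiv : ∀ x : Site d, ∑ κ : Fin d, (η x κ - η (x - e κ) κ) = 0) :
    ∑ x ∈ periodBox (d := d) (L ^ k * N), ∑ κ : Fin d, ‖η x κ‖ ^ 2
      ≤ 9 * ((L : ℝ) ^ k) ^ 2 * ∑ x ∈ periodBox (d := d) (L ^ k * N), ∑ κ : Fin d, ∑ μ : Fin d, ‖η (x + e μ) κ - η x κ‖ ^ 2 :=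
  sum_norm_sq_le_of_iterate_Qcoarse_eq_dPot_of_flatDiv hL hN k η _ hη (psi_add_period L k η ζ hη hζ)
    (funext fun w => funext fun μ => iterate_Qcoarse_coexact hL k η ζ hT w μ) hdiv

/-- **THE COARSE ENERGY OF THE STRAIGHT AVERAGE OF THE CO-CLOSED PART, N-FREE** (complex values; the S-bound in the
`Qcoarse` currency; `= (L^k)^{4−d}·G_diag(η)`) — file 1's `sum_norm_sq_iterate_Qcoarse_le_of_exact_of_flatDiv` with the potential `ψ`.
[folklore] -/
theorem sum_norm_sq_iterate_Qcoarse_coexact_le {L : ℕ} (hL : 1 ≤ L) {N : ℕ} (hN : 1 ≤ N) (k : ℕ)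
    (η : Site d → Fin d → ℂ) (ζ : Site d → ℂ)
    (hη : ∀ (x : Site d) (τ μ : Fin d), η (x + ((L ^ k * N : ℕ) : ℤ) • e τ) μ = η x μ)
    (hζ : ∀ (x : Site d) (τ : Fin d), ζ (x + ((L ^ k * N : ℕ) : ℤ) • e τ) = ζ x)
    (hT : (Tcoarse L)^[k] (fun x μ => η x μ + dPot ζ x μ) = 0)
    (hdiv : ∀ x : Site d, ∑ κ : Fin d, (η x κ - η (x - e κ) κ) = 0) :
    ∑ z ∈ periodBox (d := d) N, ∑ κ : Fin d, ‖(Qcoarse L)^[k] η z κ‖ ^ 2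
      ≤ ((((L ^ k : ℕ) : ℝ)) ^ d)⁻¹ * (((L ^ k : ℕ) : ℝ)) ^ 4
          * ∑ x ∈ periodBox (d := d) (L ^ k * N), ∑ κ : Fin d, ‖η x κ - η (x - e κ) κ‖ ^ 2 :=
  sum_norm_sq_iterate_Qcoarse_le_of_exact_of_flatDiv hL hN k η _ hη (psi_add_period L k η ζ hη hζ)
    (funext fun w => funext fun μ => iterate_Qcoarse_coexact hL k η ζ hT w μ) hdiv

end Estimates

/-! ## §3 The gradient of a co-closed periodic field IS its curl energy, and the curl does not see `dPot ζ` -/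

section Curl

variable {𝔸 : Type*} [NormedRing 𝔸]

/-- **THE PLANE CURL OF `η + dPot ζ` IS THAT OF `η`** (the curl of a coboundary vanishes identically; owner t4-ne3-p1 g22). [folklore] -/
theorem planeCurl_add_dPot (η : Site d → Fin d → 𝔸) (ζ : Site d → 𝔸) (x : Site d) (μ ν : Fin d) :
    ((η (x + e μ) ν + dPot ζ (x + e μ) ν) - (η x ν + dPot ζ x ν))
        - ((η (x + e ν) μ + dPot ζ (x + e ν) μ) - (η x μ + dPot ζ x μ))
      = (η (x + e μ) ν - η x ν) - (η (x + e ν) μ - η x μ) := by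
  have hc : x + e ν + e μ = x + e μ + e ν := add_right_comm _ _ _
  simp only [dPot, hc]
  abel

end Curl

/-- **WEITZENBÖCK FOR THE CO-CLOSED PART** (complex values): for `P ≥ 1`, `η` `P`-periodic and flat-divergence-free and any `ζ`,
`Σ_x Σ_κ Σ_μ ‖η(x+e_μ) κ − η x κ‖² = Σ_x Σ_π ‖curl_π (η + dPot ζ) x‖²` over `periodBox P` ((w2) + `planeCurl_add_dPot`). [folklore] -/
theorem sum_grad_sq_coexact_eq_planeCurl {P : ℕ} (hP : 1 ≤ P) (η : Site d → Fin d → ℂ) (ζ : Site d → ℂ)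
    (hη : ∀ (x : Site d) (κ μ : Fin d), η (x + (P : ℤ) • e κ) μ = η x μ)
    (hdiv : ∀ x : Site d, ∑ μ : Fin d, (η x μ - η (x - e μ) μ) = 0) :
    ∑ x ∈ periodBox (d := d) P, ∑ κ : Fin d, ∑ μ : Fin d, ‖η (x + e μ) κ - η x κ‖ ^ 2
      = ∑ x ∈ periodBox (d := d) P, ∑ π : Plane d,
          ‖((η (x + e π.1.1) π.1.2 + dPot ζ (x + e π.1.1) π.1.2) - (η x π.1.2 + dPot ζ x π.1.2))
            - ((η (x + e π.1.2) π.1.1 + dPot ζ (x + e π.1.2) π.1.1) - (η x π.1.1 + dPot ζ x π.1.1))‖ ^ 2 := by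
  have hW := weitzenbock_periodBox_of_div_eq_zero (E := ℂ) hP hη hdiv
  have hswap : ∑ x ∈ periodBox (d := d) P, ∑ κ : Fin d, ∑ μ : Fin d, ‖η (x + e μ) κ - η x κ‖ ^ 2
      = ∑ x ∈ periodBox (d := d) P, ∑ μ : Fin d, ∑ ν : Fin d, ‖η (x + e μ) ν - η x ν‖ ^ 2 :=
    Finset.sum_congr rfl fun _ _ => Finset.sum_comm
  rw [hswap, hW]
  refine Finset.sum_congr rfl fun x _ => Finset.sum_congr rfl fun π _ => ?_
  rw [planeCurl_add_dPot]

/-- **THE END, CURL CURRENCY — BLOCK-POINCARÉ FOR THE CO-CLOSED PART, N-FREE**: `L, N ≥ 1`; `η`, `ζ` `(L^k·N)`-periodic,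
`Y = η + dPot ζ` tangent, `η` flat-divergence-free ⇒ `Σ_x Σ_κ ‖η x κ‖² ≤ 9·(L^k)²·Σ_x Σ_π ‖curl_π Y x‖²` over `periodBox (L^k·N)`
— the co-exact half of (P♮)-flat (F-ne3p1-g21-1 §2 (b)), N-FREE, k-free, L-free. [folklore] -/
theorem sum_norm_sq_coexact_le_planeCurl {L : ℕ} (hL : 1 ≤ L) {N : ℕ} (hN : 1 ≤ N) (k : ℕ)
    (η : Site d → Fin d → ℂ) (ζ : Site d → ℂ)
    (hη : ∀ (x : Site d) (τ μ : Fin d), η (x + ((L ^ k * N : ℕ) : ℤ) • e τ) μ = η x μ)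
    (hζ : ∀ (x : Site d) (τ : Fin d), ζ (x + ((L ^ k * N : ℕ) : ℤ) • e τ) = ζ x)
    (hT : (Tcoarse L)^[k] (fun x μ => η x μ + dPot ζ x μ) = 0)
    (hdiv : ∀ x : Site d, ∑ κ : Fin d, (η x κ - η (x - e κ) κ) = 0) :
    ∑ x ∈ periodBox (d := d) (L ^ k * N), ∑ κ : Fin d, ‖η x κ‖ ^ 2
      ≤ 9 * ((L : ℝ) ^ k) ^ 2 * ∑ x ∈ periodBox (d := d) (L ^ k * N), ∑ π : Plane d,
          ‖((η (x + e π.1.1) π.1.2 + dPot ζ (x + e π.1.1) π.1.2) - (η x π.1.2 + dPot ζ x π.1.2))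
            - ((η (x + e π.1.2) π.1.1 + dPot ζ (x + e π.1.2) π.1.1) - (η x π.1.1 + dPot ζ x π.1.1))‖ ^ 2 := by
  have hLN : 1 ≤ L ^ k * N := Nat.one_le_iff_ne_zero.mpr (Nat.mul_ne_zero (by positivity) (by omega))
  rw [← sum_grad_sq_coexact_eq_planeCurl hLN η ζ hη hdiv]
  exact sum_norm_sq_coexact_le_grad hL hN k η ζ hη hζ hT hdiv

/-- **THE END, CURL CURRENCY — THE COARSE SIZE OF `(Qcoarse L)^[k] η`, N-FREE**: under the same hypotheses,
`Σ_{z∈periodBox N} Σ_κ ‖(Qcoarse L)^[k] η z κ‖² ≤ ((L^k)^d)⁻¹·(L^k)⁴·Σ_x Σ_π ‖curl_π Y x‖²` — what the H3 interpolant of the corner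
datum `−ψ` costs, up to `C_I·(L^k)^{d−2}` (F-ne3p1-g21-1 §2 (c)). [folklore] -/
theorem sum_norm_sq_iterate_Qcoarse_coexact_le_planeCurl {L : ℕ} (hL : 1 ≤ L) {N : ℕ} (hN : 1 ≤ N) (k : ℕ)
    (η : Site d → Fin d → ℂ) (ζ : Site d → ℂ)
    (hη : ∀ (x : Site d) (τ μ : Fin d), η (x + ((L ^ k * N : ℕ) : ℤ) • e τ) μ = η x μ)
    (hζ : ∀ (x : Site d) (τ : Fin d), ζ (x + ((L ^ k * N : ℕ) : ℤ) • e τ) = ζ x)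
    (hT : (Tcoarse L)^[k] (fun x μ => η x μ + dPot ζ x μ) = 0)
    (hdiv : ∀ x : Site d, ∑ κ : Fin d, (η x κ - η (x - e κ) κ) = 0) :
    ∑ z ∈ periodBox (d := d) N, ∑ κ : Fin d, ‖(Qcoarse L)^[k] η z κ‖ ^ 2
      ≤ ((((L ^ k : ℕ) : ℝ)) ^ d)⁻¹ * (((L ^ k : ℕ) : ℝ)) ^ 4 * ∑ x ∈ periodBox (d := d) (L ^ k * N), ∑ π : Plane d,
          ‖((η (x + e π.1.1) π.1.2 + dPot ζ (x + e π.1.1) π.1.2) - (η x π.1.2 + dPot ζ x π.1.2))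
            - ((η (x + e π.1.2) π.1.1 + dPot ζ (x + e π.1.2) π.1.1) - (η x π.1.1 + dPot ζ x π.1.1))‖ ^ 2 := by
  have hLN : 1 ≤ L ^ k * N := Nat.one_le_iff_ne_zero.mpr (Nat.mul_ne_zero (by positivity) (by omega))
  rw [← sum_grad_sq_coexact_eq_planeCurl hLN η ζ hη hdiv]
  refine (sum_norm_sq_iterate_Qcoarse_coexact_le hL hN k η ζ hη hζ hT hdiv).trans ?_
  exact mul_le_mul_of_nonneg_left (sum_diag_grad_sq_le hLN η hη) (by positivity)

end

end Summit.QuantumFields.BalabanUV.T4Continuum.NE3HodgeCoexactPoincare
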